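import Summits.Ventures.GridStability.Models.WSCC9LosslessLFF
import Literature.MathematicalPhysics.PowerSystems.LyapunovFunctionFamilyClosedForm
import HarnessLib

/-!
# GridStability/Lyapunov/WSCC9LffRoa — LFF producer pilot P1: a SOLVER-FREE Vu–Turitsyn certificate
# (closed-form member of the Lyapunov-function family) for the WSCC9 lossless uniform-λ variant

Cell `gridfusion` (LADDER-GRIDFUSION), LFF lane (lead 2026-08-27T01:19:25Z P1 / 01:35:18Z / 01:47:59Z:
«the remaining P1 file is the CERTIFICATE INSTANCE WSCC9LffRoa = lit-6's recipe (register §9.14) …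
owner lyap-1»); seat gridfusion-lyap-1 (g3); namespace `Summit.Ventures.GridStability.Lyapunov.WSCC9Lff`.
LABEL OF EVERY MENTION (lead): «synthetic lossless uniform-λ VARIANT of the printed 9-bus (transfer
conductances K^G dropped) — a PIPELINE demonstration, not a 9-bus sentence».

INPUTS. model-1's object `Models/WSCC9LosslessLFF.lean` (`WSCC9.postB_relL` = the h12 post-fault data
with off-diagonal conductances zeroed; `WSCC9.lffSystemOff lam` = lit-6's `System.relativeSwing` for
machines 2, 3 relative to machine 1, uniform damping ratio `λ`, the 6 ordered machine pairs as lines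
with weights `C_ij/2 > 0`, equilibrium line angles `θ*_i − θ*_j`, `θ* = angleOf` (block-C circle
points); `WSCC9.hasDerivWithinAt_lffState_off` = HYPOTHESIS-FREE bridge: every solution of
`postB_relL.toModelRel lam a′` drives the relative state along that field); lit-6's
`Certificate.relativeClosedForm` / `relativeClosedForm_well_subset_regionOfAttraction`
(`Literature/…/LyapunovFunctionFamilyClosedForm.lean`, p483522/p484126: an EXACT member of the
family [cite: VuTuritsyn2016, §III eq. (QKH)] from scalars — no SDP, no matrix certificate).

WHAT IS CERTIFIED HERE (kernel): for EVERY damping ratio `λ > 0` the closed-form data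
`N⁻¹ = [[2624/95845, −19264/6229925], [−19264/6229925, 452102/31149625]]` (exact inverse of
`diag(1/M₂, 1/M₃) + (1/M₁)𝟙𝟙ᵀ`, `M = (1182/9425, 64/1885, 301/18850)`), `ν = 3/250`
(`N⁻¹ − ν·1 ⪰ 0` by the 2×2 criterion), `c = 1`, `g = λ/2`, `c′ = 2/λ + λ/2` satisfy all ten
hypotheses of `relativeClosedForm` (`cert lam hlam`); `ker E = 0`; every equilibrium line angle has
`|θ*_i − θ*_j| < π/2` (all `θ*_i = arccos c_i ∈ [0, π/2)`); hence (`wscc9Lff_well_subset_regionOfAttraction`)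
for every level `c₀ < V(0) + c′·w_k·vtGap(θ*_k)` (all 6 lines `k`): the set `{x ∈ 𝒫 | V x ≤ c₀}` is
positively invariant and every global solution from it tends to `0`; and
(`synchronisation_of_isSolutionOn`) the same read on model-1's typed classical model: every solution
of `postB_relL.toModelRel lam a′` whose initial relative state lies in that set has relative angles
`(δ_m − δ_1) − θ*_m → 0` and relative speeds `ω_m − ω_1 → 0` (synchronisation to machine 1). The
level is kept SYMBOLIC (as in lit-6's `TwoMachine` test instance); an explicit rational level needs
only enclosures of `arccos c_i` and `π` (successor item, `Models/AngleEnclosure.lean`).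

THREE COLUMNS. CERTIFIED: the scalar/matrix facts above and the two sentences, for MODEL M′.
MODELLED: M′ = network-reduced classical 3-machine model, LOSSLESS VARIANT (MV-2L synthetic: transfer
conductances dropped, self terms kept ⇒ REDEFINED injections `P′ = P_e^{lossless}(δ*)`, MV-RD), uniform
damping `D_i = λM_i` (MV-λ), h12 data (MV-h12), reference machine 1 (RULING 13). VALIDATED: nothing.
No sentence of this file says that the WSCC 9-bus system or any grid is stable. One `def` (`cert`,
the certificate member); no named fact; standard axioms.
-/

noncomputable section

open Set Filter Topology Real Matrix
open Literature.MathematicalPhysics.PowerSystems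
open Literature.MathematicalPhysics.PowerSystems.LyapunovFunctionFamily
open Literature.MathematicalPhysics.PowerSystems.ClassicalModel.LosslessSystem (vtGap)
open Summit.Ventures.GridStability.Models

namespace Summit.Ventures.GridStability.Lyapunov.WSCC9Lff

/-! ### The system and the closed-form data -/

/-- `WSCC9.lffSystemOff lam` unfolded to lit-6's `relativeSwing` (model-1's wrappers are
definitional). -/
theorem lffSystemOff_eq (lam : ℚ) :
    WSCC9.lffSystemOff lam = (System.relativeSwing (fun m : Fin 2 => ((WSCC9.postB_relL.M m.succ : ℚ) : ℝ))
      ((WSCC9.postB_relL.M 0 : ℚ) : ℝ) (lam : ℝ) (RecastData.lffEo 2) WSCC9.postB_relL.lffWo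
      (RecastData.lffδso WSCC9.postB_relL.angleOf)) := by
  unfold WSCC9.lffSystemOff RecastData.lffSystemOff
  rfl

/-- `N⁻¹`, the exact inverse of `diag(1/M₂, 1/M₃) + (1/M₁)·𝟙𝟙ᵀ` for the WSCC9 inertias
`M = (1182/9425, 64/1885, 301/18850)`. -/
def Ninv : Matrix (Fin 2) (Fin 2) ℝ :=
  !![(2624 : ℝ) / 95845, (-19264 : ℝ) / 6229925; (-19264 : ℝ) / 6229925, (452102 : ℝ) / 31149625]

/-- The inertias `M = (1182/9425, 64/1885, 301/18850)` of the object (model-1's `WSCC9.M`). -/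
theorem M_vals : WSCC9.postB_relL.M 0 = 1182 / 9425 ∧ WSCC9.postB_relL.M 1 = 64 / 1885 ∧
    WSCC9.postB_relL.M 2 = 301 / 18850 := by decide +kernel

/-- `N⁻¹ · N = 1` (exact rational arithmetic). -/
theorem Ninv_mul :
    Ninv * (Matrix.diagonal (fun i : Fin 2 => 1 / ((WSCC9.postB_relL.M i.succ : ℚ) : ℝ))
      + Matrix.of (fun _ _ => 1 / ((WSCC9.postB_relL.M 0 : ℚ) : ℝ))) = 1 := by
  ext i j
  fin_cases i <;> fin_cases j <;>
    norm_num [Ninv, Matrix.mul_apply, Fin.sum_univ_two, Matrix.diagonal, M_vals.1, M_vals.2.1,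
      M_vals.2.2, Fin.succ_zero_eq_one, Fin.succ_one_eq_two]

/-- `N⁻¹` is symmetric. -/
theorem Ninv_transpose : Ninvᵀ = Ninv := by
  ext i j; fin_cases i <;> fin_cases j <;> rfl

/-- `N⁻¹ − ν·1 ⪰ 0` with `ν = 3/250` (2×2 criterion: diagonal entries and determinant of
`N⁻¹ − ν1` nonnegative; `λ_min(N⁻¹) ≈ 0.0138`). -/
theorem Ninv_sub_posSemidef : (Ninv - (3 / 250 : ℝ) • (1 : Matrix (Fin 2) (Fin 2) ℝ)).PosSemidef := by
  refine Matrix.PosSemidef.of_dotProduct_mulVec_nonneg ?_ fun x => ?_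
  · -- symmetric
    rw [Matrix.IsHermitian, Matrix.conjTranspose_eq_transpose_of_trivial, Matrix.transpose_sub,
      Ninv_transpose, Matrix.transpose_smul, Matrix.transpose_one]
  · -- the quadratic form `p x₀² + 2 q x₀ x₁ + r x₁²`, `p, r > 0`, `p r ≥ q²`
    have h : star x ⬝ᵥ ((Ninv - (3 / 250 : ℝ) • (1 : Matrix (Fin 2) (Fin 2) ℝ)) *ᵥ x)
        = (2624 / 95845 - 3 / 250 : ℝ) * x 0 ^ 2 + 2 * (-19264 / 6229925 : ℝ) * x 0 * x 1
          + (452102 / 31149625 - 3 / 250 : ℝ) * x 1 ^ 2 := by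
      simp [Matrix.mulVec, dotProduct, Fin.sum_univ_two, Ninv, Matrix.one_apply]
      ring
    rw [h]
    nlinarith [sq_nonneg ((2624 / 95845 - 3 / 250 : ℝ) * x 0 + (-19264 / 6229925 : ℝ) * x 1),
      sq_nonneg (x 1), sq_nonneg (x 0)]


/-! ### The certificate member (for every damping ratio `λ > 0`) -/

/-- **The closed-form Vu–Turitsyn certificate for the WSCC9 lossless uniform-λ variant**, for every
`λ > 0`: `Q = [[λ·N⁻¹, N⁻¹], [N⁻¹, c′·N⁻¹]]`, `K = c′·w`, `H = w`, `ε = νλ/2` with `c = 1`,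
`g = λ/2`, `c′ = 2/λ + λ/2` (so `c ≤ λc′`, `0 < g < λc`, `c² ≤ (λc − g)(c′ − g)` hold for all
`λ > 0`). MODELLED column object; the certificate itself is the CERTIFIED datum (type inferred:
`Certificate (System.relativeSwing …)` = `Certificate (WSCC9.lffSystemOff lam)` by `lffSystemOff_eq`).
[cite: VuTuritsyn2016, §III eq. (QKH)] -/
def cert (lam : ℚ) (hlam : 0 < lam) :=
  Certificate.relativeClosedForm (fun m : Fin 2 => ((WSCC9.postB_relL.M m.succ : ℚ) : ℝ))
    ((WSCC9.postB_relL.M 0 : ℚ) : ℝ) (lam : ℝ) (RecastData.lffEo 2) WSCC9.postB_relL.lffWo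
    (RecastData.lffδso WSCC9.postB_relL.angleOf) Ninv 1 (2 / (lam : ℝ) + (lam : ℝ) / 2) (3 / 250)
    ((lam : ℝ) / 2) Ninv_mul Ninv_transpose (by norm_num) Ninv_sub_posSemidef WSCC9.lffWo_pos
    (by exact_mod_cast hlam) one_pos
    (by have : (0 : ℝ) < lam := by exact_mod_cast hlam
        positivity)
    (by have h : (0 : ℝ) < lam := by exact_mod_cast hlam
        rw [mul_add, mul_div_cancel₀ _ h.ne']; nlinarith)
    (by have : (0 : ℝ) < lam := by exact_mod_cast hlam
        positivity)
    (by have h : (0 : ℝ) < lam := by exact_mod_cast hlam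
        linarith)
    (by have h : (0 : ℝ) < lam := by exact_mod_cast hlam
        have e : ((lam : ℝ) * 1 - (lam : ℝ) / 2) * (2 / (lam : ℝ) + (lam : ℝ) / 2 - (lam : ℝ) / 2) = 1 := by
          field_simp; ring
        rw [e]; norm_num)

/-! ### Structural facts: `ker E = 0`, equilibrium line angles inside `(−π/2, π/2)` -/

/-- `ker E = 0` for the off-diagonal line matrix (model-1's `lffEo_injective_aux`). -/
theorem kerE (v : Fin 2 → ℝ) (hv : RecastData.lffEo 2 *ᵥ v = 0) : v = 0 :=
  RecastData.lffEo_injective_aux v hv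

/-- Every equilibrium angle `θ*_i = angleOf i` of the block-C data lies in `[0, π/2)`
(`θ*_i = arccos c_i` with `s_i ≥ 0`, `c_i > 0`). -/
theorem angleOf_mem (i : Fin 3) :
    0 ≤ WSCC9.postB_relL.angleOf i ∧ WSCC9.postB_relL.angleOf i < π / 2 := by
  have hs : ∀ i : Fin 3, (0 : ℚ) ≤ WSCC9.postB_relL.s i := by decide +kernel
  have hc : ∀ i : Fin 3, (0 : ℚ) < WSCC9.postB_relL.c i := by decide +kernel
  have h1 : WSCC9.postB_relL.angleOf i = Real.arccos ((WSCC9.postB_relL.c i : ℚ) : ℝ) := by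
    unfold RecastData.angleOf; rw [if_pos (hs i)]
  rw [h1]
  refine ⟨Real.arccos_nonneg _, ?_⟩
  rw [Real.arccos_lt_pi_div_two]
  exact_mod_cast hc i

/-- **Equilibrium line angles inside the Vu–Turitsyn polytope**: `|θ*_i − θ*_j| < π/2` on every
ordered machine pair (both angles lie in `[0, π/2)`). -/
theorem abs_δs_lt (k : RecastData.LffPair 2) :
    |RecastData.lffδso WSCC9.postB_relL.angleOf k| < π / 2 := by
  show |WSCC9.postB_relL.angleOf k.1.1 - WSCC9.postB_relL.angleOf k.1.2| < π / 2
  have h1 := angleOf_mem k.1.1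
  have h2 := angleOf_mem k.1.2
  rw [abs_lt]; constructor <;> linarith

/-! ### THE CERTIFIED REGION (symbolic level) -/

/-- **P1: the certified synchronisation region of the WSCC9 lossless uniform-λ variant, from the
closed-form Vu–Turitsyn certificate** (LFF third construction, [cite: VuTuritsyn2016, §IV set ℛ]).
For every `λ > 0`, every level `c₀ < V(0) + c′·w_k·vtGap(θ*_k)` on all six ordered machine pairs
`k`, and every relative state `y` in the polytope `𝒫` with `V y ≤ c₀`: a global solution of the
relative LFF field (`= (WSCC9.lffSystemOff lam).field`, `lffSystemOff_eq`) exists, and EVERY global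
solution keeps `{𝒫, V ≤ c₀}` and tends to `0`. MODELLED: «synthetic lossless uniform-λ variant of the
printed 9-bus» (not a 9-bus sentence). No solver, no matrix certificate. -/
theorem wscc9Lff_well_subset_regionOfAttraction (lam : ℚ) (hlam : 0 < lam) {c₀ : ℝ}
    (hc₀ : ∀ k, c₀ < (cert lam hlam).V 0
      + (2 / (lam : ℝ) + (lam : ℝ) / 2) * WSCC9.postB_relL.lffWo k
        * vtGap (RecastData.lffδso WSCC9.postB_relL.angleOf k))
    {y : Fin 2 ⊕ Fin 2 → ℝ}
    (hy : y ∈ (System.relativeSwing (fun m : Fin 2 => ((WSCC9.postB_relL.M m.succ : ℚ) : ℝ))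
      ((WSCC9.postB_relL.M 0 : ℚ) : ℝ) (lam : ℝ) (RecastData.lffEo 2) WSCC9.postB_relL.lffWo
      (RecastData.lffδso WSCC9.postB_relL.angleOf)).polytope)
    (hyc : (cert lam hlam).V y ≤ c₀) :
    (∃ X : ℝ → Fin 2 ⊕ Fin 2 → ℝ, X 0 = y ∧
        ∀ T : ℝ, ∀ t ∈ Icc 0 T, HasDerivWithinAt X
          ((System.relativeSwing (fun m : Fin 2 => ((WSCC9.postB_relL.M m.succ : ℚ) : ℝ))
      ((WSCC9.postB_relL.M 0 : ℚ) : ℝ) (lam : ℝ) (RecastData.lffEo 2) WSCC9.postB_relL.lffWo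
      (RecastData.lffδso WSCC9.postB_relL.angleOf)).field (X t)) (Icc 0 T) t) ∧
      ∀ X : ℝ → Fin 2 ⊕ Fin 2 → ℝ, X 0 = y →
        (∀ T : ℝ, ∀ t ∈ Icc 0 T, HasDerivWithinAt X
          ((System.relativeSwing (fun m : Fin 2 => ((WSCC9.postB_relL.M m.succ : ℚ) : ℝ))
      ((WSCC9.postB_relL.M 0 : ℚ) : ℝ) (lam : ℝ) (RecastData.lffEo 2) WSCC9.postB_relL.lffWo
      (RecastData.lffδso WSCC9.postB_relL.angleOf)).field (X t)) (Icc 0 T) t) →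
        (∀ t, 0 ≤ t → X t ∈ (System.relativeSwing (fun m : Fin 2 => ((WSCC9.postB_relL.M m.succ : ℚ) : ℝ))
      ((WSCC9.postB_relL.M 0 : ℚ) : ℝ) (lam : ℝ) (RecastData.lffEo 2) WSCC9.postB_relL.lffWo
      (RecastData.lffδso WSCC9.postB_relL.angleOf)).polytope ∧ (cert lam hlam).V (X t) ≤ c₀) ∧
          Tendsto X atTop (𝓝 0) :=
  Certificate.relativeClosedForm_well_subset_regionOfAttraction
    (fun m : Fin 2 => ((WSCC9.postB_relL.M m.succ : ℚ) : ℝ)) ((WSCC9.postB_relL.M 0 : ℚ) : ℝ)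
    (lam : ℝ) (RecastData.lffEo 2) WSCC9.postB_relL.lffWo (RecastData.lffδso WSCC9.postB_relL.angleOf)
    Ninv 1 (2 / (lam : ℝ) + (lam : ℝ) / 2) (3 / 250) ((lam : ℝ) / 2) _ _ _ _ _ _ _ _ _ _ _ _ kerE
    abs_δs_lt hc₀ hy hyc

/-- **P1 read on model-1's typed classical model (hypothesis-free bridge).** For every `λ > 0`,
every common acceleration `a′`, every level `c₀` as above and EVERY solution `c` of the lossless
WSCC9 variant `postB_relL.toModelRel lam a′` on all of `ℝ` (derivatives within `univ`) whose initial
relative state `x(0) = ((δ_m − δ_1) − θ*_m, ω_m − ω_1)_{m=2,3}` lies in the polytope with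
`V(x(0)) ≤ c₀`: the relative state keeps `{𝒫, V ≤ c₀}` for all `t ≥ 0` and tends to `0` — machines
2 and 3 synchronise with machine 1 at the relative angles `θ*`. MODELLED as above; no sentence here
says a grid is stable. [cite: VuTuritsyn2016, §IV set ℛ; SauerPai1998, §6.10 eqs. (6.238)–(6.241)] -/
theorem synchronisation_of_isSolutionOn (lam : ℚ) (hlam : 0 < lam) (a : ℝ) {c₀ : ℝ}
    (hc₀ : ∀ k, c₀ < (cert lam hlam).V 0
      + (2 / (lam : ℝ) + (lam : ℝ) / 2) * WSCC9.postB_relL.lffWo k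
        * vtGap (RecastData.lffδso WSCC9.postB_relL.angleOf k))
    {c : ℝ → ClassicalSwing.State 3}
    (hc : (WSCC9.postB_relL.toModelRel lam a).IsSolutionOn c univ)
    (hy : RecastData.lffState WSCC9.postB_relL.angleOf (c 0) ∈
      (System.relativeSwing (fun m : Fin 2 => ((WSCC9.postB_relL.M m.succ : ℚ) : ℝ))
      ((WSCC9.postB_relL.M 0 : ℚ) : ℝ) (lam : ℝ) (RecastData.lffEo 2) WSCC9.postB_relL.lffWo
      (RecastData.lffδso WSCC9.postB_relL.angleOf)).polytope)
    (hyc : (cert lam hlam).V (RecastData.lffState WSCC9.postB_relL.angleOf (c 0)) ≤ c₀) :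
    (∀ t, 0 ≤ t →
        RecastData.lffState WSCC9.postB_relL.angleOf (c t) ∈
            (System.relativeSwing (fun m : Fin 2 => ((WSCC9.postB_relL.M m.succ : ℚ) : ℝ))
      ((WSCC9.postB_relL.M 0 : ℚ) : ℝ) (lam : ℝ) (RecastData.lffEo 2) WSCC9.postB_relL.lffWo
      (RecastData.lffδso WSCC9.postB_relL.angleOf)).polytope ∧
          (cert lam hlam).V (RecastData.lffState WSCC9.postB_relL.angleOf (c t)) ≤ c₀) ∧
      Tendsto (fun t => RecastData.lffState WSCC9.postB_relL.angleOf (c t)) atTop (𝓝 0) := by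
  obtain ⟨-, hall⟩ := wscc9Lff_well_subset_regionOfAttraction lam hlam hc₀ hy hyc
  refine hall (fun t => RecastData.lffState WSCC9.postB_relL.angleOf (c t)) rfl fun T t _ => ?_
  have h := (WSCC9.hasDerivWithinAt_lffState_off lam a hc (mem_univ t)).mono (subset_univ (Icc 0 T))
  rw [lffSystemOff_eq] at h
  exact h

end Summit.Ventures.GridStability.Lyapunov.WSCC9Lff

end
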